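import Mathlib.Analysis.InnerProductSpace.PiL2
import Mathlib.Analysis.Calculus.FDeriv.Bilinear
import Mathlib.Analysis.Calculus.FDeriv.Mul
import Mathlib.Analysis.Calculus.ContDiff.Basic
import HarnessLib

/-!
# Angular-momentum vector fields and the spherical part of the Laplacian

Analysis support file (everything proved; one definition, no named facts) for the cylindrical
coordinates of A. Waldron, *Long-time existence for Yang–Mills flow*, Invent. math. 217 (2019),
§4, done extrinsically on `ℝⁿ ∖ {0}`: for an orthonormal frame `b` the **angular-momentum fields**
`L_{ij}(x) = ⟨x, bᵢ⟩ bⱼ − ⟨x, bⱼ⟩ bᵢ` are tangent to the spheres `‖x‖ = r`, and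

* `sum_sum_inner_angularField_mul` — the Lagrange identity in polarized form
  `∑ᵢ∑ⱼ ⟨L_{ij}x, w⟩⟨L_{ij}x, w'⟩ = 2(‖x‖²⟨w, w'⟩ − ⟨x, w⟩⟨x, w'⟩)`, i.e.
  `∑ᵢ∑ⱼ L_{ij}x ⊗ L_{ij}x = 2(‖x‖² 𝟙 − x ⊗ x)` (twice `‖x‖²` times the projection onto `x^⊥`);
* `sum_sum_bilinear_angularField` — for every bilinear form `B`,
  `∑ᵢ∑ⱼ B(L_{ij}x, L_{ij}x) = 2(‖x‖² ∑ₖ B(bₖ, bₖ) − B(x, x))`;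
* `sum_sum_angularField_angularField` — `∑ᵢ∑ⱼ L_{ij}(L_{ij}x) = −2(n − 1) x`;
* `sum_sum_fderiv_fderiv_angularField` — **the spherical part of the flat Laplacian**: for `q`
  twice differentiable at `x`,
  `∑ᵢ∑ⱼ ∂_{L_{ij}}∂_{L_{ij}} q (x) = 2(‖x‖² Δq(x) − D²q(x)(x, x) − (n − 1) Dq(x)(x))`,
  the coordinate-free form of `Δ = ∂ᵣ² + ((n−1)/r)∂ᵣ + r⁻² Δ_{S^{n−1}}` with
  `Δ_{S^{n−1}} = ½∑ᵢ∑ⱼ ∂_{L_{ij}}²` on functions.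

References: A. Waldron, Invent. math. 217 (2019), §4.1–4.2 [Waldron2019]; (angular momentum
operators and the spherical Laplacian) [folklore].
-/

noncomputable section

open scoped RealInnerProductSpace
open Finset

namespace Literature.Analysis.Calculus

variable {E : Type*} [NormedAddCommGroup E] [InnerProductSpace ℝ E]
variable {ι : Type*} [Fintype ι]

/-- **The angular-momentum vector field** of the coordinate plane `(bᵢ, bⱼ)` of a frame `b`:
`L_{ij}(x) = ⟨x, bᵢ⟩ bⱼ − ⟨x, bⱼ⟩ bᵢ` (the generator of the rotations in that plane; tangent to
the spheres centred at the origin). [folklore] -/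
def angularField (b : OrthonormalBasis ι ℝ E) (i j : ι) (x : E) : E :=
  ⟪x, b i⟫ • b j - ⟪x, b j⟫ • b i

omit [Fintype ι] in
/-- Unfolding lemma. [folklore] -/
theorem angularField_apply [Fintype ι] (b : OrthonormalBasis ι ℝ E) (i j : ι) (x : E) :
    angularField b i j x = ⟪x, b i⟫ • b j - ⟪x, b j⟫ • b i := rfl

/-- `L_{ij}` is linear: as a continuous linear map. [folklore] -/
theorem angularField_eq_clm (b : OrthonormalBasis ι ℝ E) (i j : ι) (x : E) :
    angularField b i j x =
      ((innerSL ℝ (b i)).smulRight (b j) - (innerSL ℝ (b j)).smulRight (b i)) x := by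
  simp [angularField, real_inner_comm]

/-- The angular-momentum fields are tangent to the spheres: `⟨L_{ij}x, x⟩ = 0`. [folklore] -/
theorem inner_angularField_self (b : OrthonormalBasis ι ℝ E) (i j : ι) (x : E) :
    ⟪angularField b i j x, x⟫ = 0 := by
  simp only [angularField, inner_sub_left, inner_smul_left, RCLike.conj_to_real]
  rw [real_inner_comm x (b i), real_inner_comm x (b j)]
  ring

/-- The components of `L_{ij}x` against a vector `w`: `⟨L_{ij}x, w⟩ = xᵢwⱼ − xⱼwᵢ`. [folklore] -/
theorem inner_angularField (b : OrthonormalBasis ι ℝ E) (i j : ι) (x w : E) :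
    ⟪angularField b i j x, w⟫ = ⟪x, b i⟫ * ⟪b j, w⟫ - ⟪x, b j⟫ * ⟪b i, w⟫ := by
  simp only [angularField, inner_sub_left, inner_smul_left, RCLike.conj_to_real]

/-- **Lagrange's identity, polarized**: `∑ᵢ∑ⱼ ⟨L_{ij}x, w⟩⟨L_{ij}x, w'⟩ = 2(‖x‖²⟨w,w'⟩ − ⟨x,w⟩⟨x,w'⟩)`.
[folklore] -/
theorem sum_sum_inner_angularField_mul (b : OrthonormalBasis ι ℝ E) (x w w' : E) :
    ∑ i, ∑ j, ⟪angularField b i j x, w⟫ * ⟪angularField b i j x, w'⟫ =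
      2 * (‖x‖ ^ 2 * ⟪w, w'⟫ - ⟪x, w⟫ * ⟪x, w'⟫) := by
  simp_rw [inner_angularField]
  -- coordinates
  have hxx : ∑ i, ⟪x, b i⟫ * ⟪x, b i⟫ = ‖x‖ ^ 2 := by
    rw [← real_inner_self_eq_norm_sq, ← b.sum_inner_mul_inner x x]
    exact Finset.sum_congr rfl fun i _ => by rw [real_inner_comm (b i) x]
  have hww : ∑ i, ⟪b i, w⟫ * ⟪b i, w'⟫ = ⟪w, w'⟫ := by
    rw [← b.sum_inner_mul_inner w w']
    exact Finset.sum_congr rfl fun i _ => by rw [real_inner_comm (b i) w]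
  have hxw : ∑ i, ⟪x, b i⟫ * ⟪b i, w⟫ = ⟪x, w⟫ := b.sum_inner_mul_inner x w
  have hxw' : ∑ i, ⟪x, b i⟫ * ⟪b i, w'⟫ = ⟪x, w'⟫ := b.sum_inner_mul_inner x w'
  -- expand the products and distribute the sums
  have hexp : ∀ i j, (⟪x, b i⟫ * ⟪b j, w⟫ - ⟪x, b j⟫ * ⟪b i, w⟫) *
      (⟪x, b i⟫ * ⟪b j, w'⟫ - ⟪x, b j⟫ * ⟪b i, w'⟫) =
      ⟪x, b i⟫ * ⟪x, b i⟫ * (⟪b j, w⟫ * ⟪b j, w'⟫) + ⟪x, b j⟫ * ⟪x, b j⟫ * (⟪b i, w⟫ * ⟪b i, w'⟫) -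
        (⟪x, b i⟫ * ⟪b i, w'⟫) * (⟪x, b j⟫ * ⟪b j, w⟫) -
        (⟪x, b i⟫ * ⟪b i, w⟫) * (⟪x, b j⟫ * ⟪b j, w'⟫) := fun i j => by ring
  simp_rw [hexp, Finset.sum_sub_distrib, Finset.sum_add_distrib, ← Finset.mul_sum, ← Finset.sum_mul,
    hww, hxw, hxw']
  rw [hxx, ← Finset.mul_sum, hww]
  ring

/-- **Contraction of a bilinear form with the angular fields**:
`∑ᵢ∑ⱼ B(L_{ij}x, L_{ij}x) = 2(‖x‖² ∑ₖ B(bₖ,bₖ) − B(x,x))`. [folklore] -/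
theorem sum_sum_bilinear_angularField (b : OrthonormalBasis ι ℝ E) (B : E →L[ℝ] E →L[ℝ] ℝ)
    (x : E) :
    ∑ i, ∑ j, B (angularField b i j x) (angularField b i j x) =
      2 * (‖x‖ ^ 2 * ∑ k, B (b k) (b k) - B x x) := by
  -- expand `L_{ij}x` and use bilinearity
  have hL : ∀ i j, B (angularField b i j x) (angularField b i j x) =
      ⟪x, b i⟫ * ⟪x, b i⟫ * B (b j) (b j) + ⟪x, b j⟫ * ⟪x, b j⟫ * B (b i) (b i) -
        ⟪x, b i⟫ * ⟪x, b j⟫ * (B (b j) (b i) + B (b i) (b j)) := by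
    intro i j
    simp only [angularField, map_sub, map_smul, FunLike.coe_sub, FunLike.coe_smul,
      Pi.sub_apply, Pi.smul_apply, smul_eq_mul]
    ring
  have hxx : ∑ i, ⟪x, b i⟫ * ⟪x, b i⟫ = ‖x‖ ^ 2 := by
    rw [← real_inner_self_eq_norm_sq, ← b.sum_inner_mul_inner x x]
    exact Finset.sum_congr rfl fun i _ => by rw [real_inner_comm (b i) x]
  -- `B(x, x)` in coordinates
  have hBxx : B x x = ∑ i, ∑ j, ⟪x, b i⟫ * ⟪x, b j⟫ * B (b j) (b i) := by
    conv_lhs => rw [← b.sum_repr' x]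
    simp only [map_sum, map_smul, FunLike.coe_sum, FunLike.coe_smul,
      Finset.sum_apply, Pi.smul_apply, smul_eq_mul, Finset.mul_sum]
    refine Finset.sum_congr rfl fun i _ => Finset.sum_congr rfl fun j _ => ?_
    rw [real_inner_comm (b i) x, real_inner_comm (b j) x]; ring
  have hBxx' : ∑ i, ∑ j, ⟪x, b i⟫ * ⟪x, b j⟫ * B (b i) (b j) = B x x := by
    rw [hBxx, Finset.sum_comm]
    exact Finset.sum_congr rfl fun i _ => Finset.sum_congr rfl fun j _ => by ring
  simp_rw [hL, Finset.sum_sub_distrib, Finset.sum_add_distrib, mul_add, Finset.sum_add_distrib]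
  rw [show ∑ i, ∑ j, ⟪x, b i⟫ * ⟪x, b i⟫ * B (b j) (b j) = ‖x‖ ^ 2 * ∑ k, B (b k) (b k) by
      rw [← hxx, Finset.sum_mul]; exact Finset.sum_congr rfl fun i _ => by rw [Finset.mul_sum],
    show ∑ i, ∑ j, ⟪x, b j⟫ * ⟪x, b j⟫ * B (b i) (b i) = ‖x‖ ^ 2 * ∑ k, B (b k) (b k) by
      rw [Finset.sum_comm, ← hxx, Finset.sum_mul]
      exact Finset.sum_congr rfl fun i _ => by rw [Finset.mul_sum],
    hBxx', show ∑ i, ∑ j, ⟪x, b i⟫ * ⟪x, b j⟫ * B (b j) (b i) = B x x from hBxx.symm]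
  ring

/-- **Iterating the angular fields**: `∑ᵢ∑ⱼ L_{ij}(L_{ij}x) = −2(n − 1) x` (`n = card ι`).
[folklore] -/
theorem sum_sum_angularField_angularField [DecidableEq ι] (b : OrthonormalBasis ι ℝ E) (x : E) :
    ∑ i, ∑ j, angularField b i j (angularField b i j x) =
      -(2 * ((Fintype.card ι : ℝ) - 1)) • x := by
  -- test against an arbitrary vector `w`
  apply ext_inner_left ℝ
  intro w
  have hon : ∀ i j, ⟪b i, b j⟫ = if i = j then (1 : ℝ) else 0 := fun i j => by
    rw [b.inner_eq_ite]
  have key : ∀ i j, ⟪w, angularField b i j (angularField b i j x)⟫ =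
      (if i = j then ⟪x, b i⟫ * ⟪w, b j⟫ + ⟪x, b j⟫ * ⟪w, b i⟫ else 0) -
        ⟪x, b j⟫ * ⟪w, b j⟫ - ⟪x, b i⟫ * ⟪w, b i⟫ := by
    intro i j
    rw [real_inner_comm, inner_angularField, inner_angularField, inner_angularField, hon j i, hon i i,
      hon j j, hon i j, real_inner_comm (b j) w, real_inner_comm (b i) w]
    by_cases h : i = j
    · subst h; simp
    · simp [h, Ne.symm h]
  simp_rw [inner_sum, key, Finset.sum_sub_distrib, Finset.sum_ite_eq, Finset.mem_univ, if_true]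
  have hxw : ∑ i, ⟪x, b i⟫ * ⟪w, b i⟫ = ⟪w, x⟫ := by
    rw [← b.sum_inner_mul_inner w x]
    exact Finset.sum_congr rfl fun i _ => by rw [real_inner_comm (b i) x]; ring
  have h2 : ∑ i, (⟪x, b i⟫ * ⟪w, b i⟫ + ⟪x, b i⟫ * ⟪w, b i⟫) = 2 * ⟪w, x⟫ := by
    rw [← hxw, Finset.mul_sum]; exact Finset.sum_congr rfl fun i _ => by ring
  have h3 : ∑ _i : ι, ∑ j, ⟪x, b j⟫ * ⟪w, b j⟫ = (Fintype.card ι : ℝ) * ⟪w, x⟫ := by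
    rw [Finset.sum_const, Finset.card_univ, hxw, nsmul_eq_mul]
  have h4 : ∑ i, ∑ _j : ι, ⟪x, b i⟫ * ⟪w, b i⟫ = (Fintype.card ι : ℝ) * ⟪w, x⟫ := by
    simp only [Finset.sum_const, Finset.card_univ, nsmul_eq_mul]
    rw [← Finset.mul_sum, hxw]
  rw [h2, h3, h4, inner_smul_right]
  ring

/-! ### The spherical part of the Laplacian -/

/-- The angular field as a fixed continuous linear map `T_{ij}` (so `fderiv L_{ij} = T_{ij}`).
[folklore] -/
theorem hasFDerivAt_angularField (b : OrthonormalBasis ι ℝ E) (i j : ι) (x : E) :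
    HasFDerivAt (angularField b i j)
      ((innerSL ℝ (b i)).smulRight (b j) - (innerSL ℝ (b j)).smulRight (b i)) x := by
  have h : angularField b i j =
      fun y => ((innerSL ℝ (b i)).smulRight (b j) - (innerSL ℝ (b j)).smulRight (b i)) y :=
    funext fun y => angularField_eq_clm b i j y
  rw [h]
  exact ContinuousLinearMap.hasFDerivAt _

/-- **The second angular derivatives and the Hessian**: for `q` twice differentiable at `x`
(`fderiv q` differentiable at `x`, `q` differentiable near `x`),
`∂_{L_{ij}}(∂_{L_{ij}} q)(x) = D²q(x)(L_{ij}x, L_{ij}x) + Dq(x)(L_{ij}(L_{ij}x))`. [folklore] -/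
theorem fderiv_fderiv_angularField_apply (b : OrthonormalBasis ι ℝ E) {q : E → ℝ} {x : E}
    (hq : DifferentiableAt ℝ (fderiv ℝ q) x) (i j : ι) :
    fderiv ℝ (fun y => fderiv ℝ q y (angularField b i j y)) x (angularField b i j x) =
      fderiv ℝ (fderiv ℝ q) x (angularField b i j x) (angularField b i j x) +
        fderiv ℝ q x (angularField b i j (angularField b i j x)) := by
  have hL := hasFDerivAt_angularField b i j x
  rw [fderiv_clm_apply hq hL.differentiableAt, hL.fderiv]
  simp only [FunLike.coe_add, Pi.add_apply, ContinuousLinearMap.comp_apply,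
    ContinuousLinearMap.flip_apply]
  rw [← angularField_eq_clm, add_comm]

/-- **The spherical part of the flat Laplacian.** For `q` with `fderiv q` differentiable at `x`:
`∑ᵢ∑ⱼ ∂_{L_{ij}}(∂_{L_{ij}}q)(x) = 2(‖x‖² ∑ₖ D²q(x)(bₖ,bₖ) − D²q(x)(x,x) − (n−1) Dq(x)(x))`
(`n = card ι`), i.e. `Δ = ∂ᵣ² + ((n−1)/r)∂ᵣ + r⁻²·½∑ᵢ∑ⱼ∂_{L_{ij}}²` on functions.
[cite: Waldron2019, §4.1–4.2 (the spherical Laplacian in cylindrical coordinates)] -/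
theorem sum_sum_fderiv_fderiv_angularField [DecidableEq ι] (b : OrthonormalBasis ι ℝ E)
    {q : E → ℝ} {x : E} (hq : DifferentiableAt ℝ (fderiv ℝ q) x) :
    ∑ i, ∑ j, fderiv ℝ (fun y => fderiv ℝ q y (angularField b i j y)) x (angularField b i j x) =
      2 * (‖x‖ ^ 2 * ∑ k, fderiv ℝ (fderiv ℝ q) x (b k) (b k) - fderiv ℝ (fderiv ℝ q) x x x -
        ((Fintype.card ι : ℝ) - 1) * fderiv ℝ q x x) := by
  simp_rw [fderiv_fderiv_angularField_apply b hq, Finset.sum_add_distrib]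
  rw [sum_sum_bilinear_angularField b (fderiv ℝ (fderiv ℝ q) x) x]
  have hsum : ∑ i, ∑ j, fderiv ℝ q x (angularField b i j (angularField b i j x)) =
      fderiv ℝ q x (∑ i, ∑ j, angularField b i j (angularField b i j x)) := by
    simp only [map_sum]
  rw [hsum, sum_sum_angularField_angularField b x, map_smul, smul_eq_mul]
  ring

end Literature.Analysis.Calculus
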